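import Summits.CriticalPhenomena.PercolationContinuityZ3.Theorems.PercNearOneGluingNoHeavyLowerTailPairObserverIntegralBase
import HarnessLib

/-!
# `NoHeavyLowerTail` (stmt-CriticalPhenomena-4575) — the (DC) induction shell on ALL fractional pairs (star pairs and pairs of `K`)

Support file (prover `prim-hp-3`, hull-port line; `--supports stmt-CriticalPhenomena-4575`).  No definitions, no named facts, no sorries.

Companion of `…DCInductionShell.lean` (same setting and notation: two pendant stars `o₁ ≠ o₂ ∉ A`, `w s(o₁,o₂) = 0`, all star pairs to relays;
E-mass `E_w(v)`, lightness `I_w`, ports, (DC) = "every relay `v` has a port `p` (or `E_w(v) = 0`) with `E_w(v) ≤ I_w(p)`").  The class of two-pendant-stars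
weight functions is closed under deleting or contracting ANY pair, not only star pairs, and the base of the induction (`obsE_pair_le_port_of_integral`)
only needs the STAR pairs to be integral.  So the induction can run on the number of ALL pairs of weight in `(0,1)`:

* `HullPort.fractionalPairs_erase_lt` — deleting a fractional pair lowers that number.
* `HullPort.dc_of_outsiderStepAll` — OUTSIDER STEP (with the induction hypothesis available for every two-pendant-stars `w'` with fewer fractional
  pairs, in particular for `w[f↦0]`, `w[f↦1]` for every fractional pair `f` of `K`) → (DC).  Ports and the base are handled inside as in `dc_of_outsiderStep`.
WHY (crux notes `run/shared/lean/prim/prim-hp-3/HULLPORT-REF-gen6.md` §12–§13): the single-STAR-edge law SHARP of `…DCSharpStep.lean` fails on instances with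
glued ports (ttrl census, 22 exact counterexamples) while (DC) holds there through a pair of `K` — the law SHARP-ANY of `…DCSharpAnyStep.lean`.
-/

noncomputable section

namespace Summit.CriticalPhenomena.PercolationContinuityZ3.Theorems

open MeasureTheory Set Literature.Probability.LatticeModels Literature.Probability.Percolation
open scoped Classical BigOperators

variable {n : ℕ}

namespace HullPort

/-- Deleting a pair of weight in `(0,1)` lowers the number of pairs of weight in `(0,1)`. [folklore] -/
theorem fractionalPairs_erase_lt (u : Sym2 (Fin n) → unitInterval) (f : Sym2 (Fin n)) (hf0 : u f ≠ 0) (hf1 : u f ≠ 1) :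
    (Finset.univ.filter fun e : Sym2 (Fin n) => (Function.update u f 0) e ≠ 0 ∧ (Function.update u f 0) e ≠ 1).card <
      (Finset.univ.filter fun e : Sym2 (Fin n) => u e ≠ 0 ∧ u e ≠ 1).card := by
  apply Finset.card_lt_card
  refine ⟨?_, ?_⟩
  · intro e he
    rw [Finset.mem_filter] at he ⊢
    refine ⟨he.1, ?_⟩
    by_cases h : e = f
    · rw [h, Function.update_self] at he; exact absurd rfl he.2.1
    · rw [Function.update_of_ne h] at he; exact he.2
  · intro hsub
    have hf : f ∈ (Finset.univ.filter fun e : Sym2 (Fin n) => u e ≠ 0 ∧ u e ≠ 1) := Finset.mem_filter.2 ⟨Finset.mem_univ _, hf0, hf1⟩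
    have := (Finset.mem_filter.1 (hsub hf)).2.1
    rw [Function.update_self] at this
    exact this rfl

/-- Raising a pair of weight in `(0,1)` to weight one lowers the number of pairs of weight in `(0,1)`. [folklore] -/
theorem fractionalPairs_glue_lt (u : Sym2 (Fin n) → unitInterval) (f : Sym2 (Fin n)) (hf0 : u f ≠ 0) (hf1 : u f ≠ 1) :
    (Finset.univ.filter fun e : Sym2 (Fin n) => (Function.update u f 1) e ≠ 0 ∧ (Function.update u f 1) e ≠ 1).card <
      (Finset.univ.filter fun e : Sym2 (Fin n) => u e ≠ 0 ∧ u e ≠ 1).card := by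
  apply Finset.card_lt_card
  refine ⟨?_, ?_⟩
  · intro e he
    rw [Finset.mem_filter] at he ⊢
    refine ⟨he.1, ?_⟩
    by_cases h : e = f
    · rw [h, Function.update_self] at he; exact absurd rfl he.2.2
    · rw [Function.update_of_ne h] at he; exact he.2
  · intro hsub
    have hf : f ∈ (Finset.univ.filter fun e : Sym2 (Fin n) => u e ≠ 0 ∧ u e ≠ 1) := Finset.mem_filter.2 ⟨Finset.mem_univ _, hf0, hf1⟩
    have := (Finset.mem_filter.1 (hsub hf)).2.2
    rw [Function.update_self] at this
    exact this rfl

/-- **(DC) from the OUTSIDER STEP, induction on ALL fractional pairs.**  Hypothesis `hOut` (the outsider step, for all two-pendant-stars weight functions on `Fin n` with the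
relays `A`, observers `o₁, o₂`, level `j`): if (DC) holds for every two-pendant-stars `w'` with fewer PAIRS (star or not) of weight in `(0,1)` than `w`,
then for every relay `v ∈ A` outside the ports of `w` (`w s(o₁,v) = w s(o₂,v) = 0`), provided `w` has a star pair of weight in `(0,1)`, there is
a port `p` (or `E_w(v) = 0`) with `E_w(v) ≤ I_w(p)`.  Conclusion: (DC) for every two-pendant-stars `w`.  Induction on the number of ALL fractional
pairs: base `obsE_pair_le_port_of_integral`; ports by the port step (`obsE_le_max_of_erase`, `obsE_le_of_common_witness`,
`obsE_weight_one_le`); outsiders by `hOut`. [this work] -/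
theorem dc_of_outsiderStepAll (A : Finset (Fin n)) (o₁ o₂ : Fin n) (j : ℕ)
    (hOut : ∀ w : Sym2 (Fin n) → unitInterval,
      o₁ ∉ A → o₂ ∉ A → o₁ ≠ o₂ → w s(o₁, o₂) = 0 → (∀ u, w s(o₁, u) ≠ 0 → u ∈ A) → (∀ u, w s(o₂, u) ≠ 0 → u ∈ A) →
      -- induction hypothesis: (DC) for every two-pendant-stars `w'` with fewer fractional star pairs
      (∀ w' : Sym2 (Fin n) → unitInterval,
        w' s(o₁, o₂) = 0 → (∀ u, w' s(o₁, u) ≠ 0 → u ∈ A) → (∀ u, w' s(o₂, u) ≠ 0 → u ∈ A) →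
        (Finset.univ.filter fun e : Sym2 (Fin n) => w' e ≠ 0 ∧ w' e ≠ 1).card <
          (Finset.univ.filter fun e : Sym2 (Fin n) => w e ≠ 0 ∧ w e ≠ 1).card →
        ∀ v ∈ A, ∃ p ∈ A, ((prodBernoulli w').real {ω : BondConfig (Fin n) | (∀ x ∈ ({o₁, o₂} : Finset (Fin n)), ω ∉ openConn v x) ∧
              1 ≤ (A.filter fun z => ∃ x ∈ ({o₁, o₂} : Finset (Fin n)), ω ∈ openConn x z).card ∧
              (A.filter fun z => ∃ x ∈ ({o₁, o₂} : Finset (Fin n)), ω ∈ openConn x z).card ≤ j} +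
            (prodBernoulli w').real {ω : BondConfig (Fin n) | (∃ x ∈ ({o₁, o₂} : Finset (Fin n)), ω ∈ openConn v x) ∧
              (A.filter fun z => ω ∈ openConn v z).card ≤ j} = 0 ∨ w' s(o₁, p) ≠ 0 ∨ w' s(o₂, p) ≠ 0) ∧
          (prodBernoulli w').real {ω : BondConfig (Fin n) | (∀ x ∈ ({o₁, o₂} : Finset (Fin n)), ω ∉ openConn v x) ∧
              1 ≤ (A.filter fun z => ∃ x ∈ ({o₁, o₂} : Finset (Fin n)), ω ∈ openConn x z).card ∧
              (A.filter fun z => ∃ x ∈ ({o₁, o₂} : Finset (Fin n)), ω ∈ openConn x z).card ≤ j} +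
            (prodBernoulli w').real {ω : BondConfig (Fin n) | (∃ x ∈ ({o₁, o₂} : Finset (Fin n)), ω ∈ openConn v x) ∧
              (A.filter fun z => ω ∈ openConn v z).card ≤ j} ≤
          (prodBernoulli w').real {ω : BondConfig (Fin n) | (A.filter fun z => ω ∈ openConn p z).card ≤ j}) →
      -- the outsider and a fractional star pair
      ∀ v ∈ A, w s(o₁, v) = 0 → w s(o₂, v) = 0 →
      (∃ a ∈ A, (w s(o₁, a) ≠ 0 ∧ w s(o₁, a) ≠ 1) ∨ (w s(o₂, a) ≠ 0 ∧ w s(o₂, a) ≠ 1)) →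
      ∃ p ∈ A, ((prodBernoulli w).real {ω : BondConfig (Fin n) | (∀ x ∈ ({o₁, o₂} : Finset (Fin n)), ω ∉ openConn v x) ∧
            1 ≤ (A.filter fun z => ∃ x ∈ ({o₁, o₂} : Finset (Fin n)), ω ∈ openConn x z).card ∧
            (A.filter fun z => ∃ x ∈ ({o₁, o₂} : Finset (Fin n)), ω ∈ openConn x z).card ≤ j} +
          (prodBernoulli w).real {ω : BondConfig (Fin n) | (∃ x ∈ ({o₁, o₂} : Finset (Fin n)), ω ∈ openConn v x) ∧
            (A.filter fun z => ω ∈ openConn v z).card ≤ j} = 0 ∨ w s(o₁, p) ≠ 0 ∨ w s(o₂, p) ≠ 0) ∧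
        (prodBernoulli w).real {ω : BondConfig (Fin n) | (∀ x ∈ ({o₁, o₂} : Finset (Fin n)), ω ∉ openConn v x) ∧
            1 ≤ (A.filter fun z => ∃ x ∈ ({o₁, o₂} : Finset (Fin n)), ω ∈ openConn x z).card ∧
            (A.filter fun z => ∃ x ∈ ({o₁, o₂} : Finset (Fin n)), ω ∈ openConn x z).card ≤ j} +
          (prodBernoulli w).real {ω : BondConfig (Fin n) | (∃ x ∈ ({o₁, o₂} : Finset (Fin n)), ω ∈ openConn v x) ∧
            (A.filter fun z => ω ∈ openConn v z).card ≤ j} ≤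
        (prodBernoulli w).real {ω : BondConfig (Fin n) | (A.filter fun z => ω ∈ openConn p z).card ≤ j})
    (w : Sym2 (Fin n) → unitInterval)
    (ho₁A : o₁ ∉ A) (ho₂A : o₂ ∉ A) (h12 : o₁ ≠ o₂) (hw12 : w s(o₁, o₂) = 0)
    (hpend₁ : ∀ u, w s(o₁, u) ≠ 0 → u ∈ A) (hpend₂ : ∀ u, w s(o₂, u) ≠ 0 → u ∈ A) :
    ∀ v ∈ A, ∃ p ∈ A, ((prodBernoulli w).real {ω : BondConfig (Fin n) | (∀ x ∈ ({o₁, o₂} : Finset (Fin n)), ω ∉ openConn v x) ∧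
          1 ≤ (A.filter fun z => ∃ x ∈ ({o₁, o₂} : Finset (Fin n)), ω ∈ openConn x z).card ∧
          (A.filter fun z => ∃ x ∈ ({o₁, o₂} : Finset (Fin n)), ω ∈ openConn x z).card ≤ j} +
        (prodBernoulli w).real {ω : BondConfig (Fin n) | (∃ x ∈ ({o₁, o₂} : Finset (Fin n)), ω ∈ openConn v x) ∧
          (A.filter fun z => ω ∈ openConn v z).card ≤ j} = 0 ∨ w s(o₁, p) ≠ 0 ∨ w s(o₂, p) ≠ 0) ∧
      (prodBernoulli w).real {ω : BondConfig (Fin n) | (∀ x ∈ ({o₁, o₂} : Finset (Fin n)), ω ∉ openConn v x) ∧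
          1 ≤ (A.filter fun z => ∃ x ∈ ({o₁, o₂} : Finset (Fin n)), ω ∈ openConn x z).card ∧
          (A.filter fun z => ∃ x ∈ ({o₁, o₂} : Finset (Fin n)), ω ∈ openConn x z).card ≤ j} +
        (prodBernoulli w).real {ω : BondConfig (Fin n) | (∃ x ∈ ({o₁, o₂} : Finset (Fin n)), ω ∈ openConn v x) ∧
          (A.filter fun z => ω ∈ openConn v z).card ≤ j} ≤
      (prodBernoulli w).real {ω : BondConfig (Fin n) | (A.filter fun z => ω ∈ openConn p z).card ≤ j} := by
  -- abbreviations (as functions of the weight function)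
  let Emass : (Sym2 (Fin n) → unitInterval) → Fin n → ℝ := fun u v =>
    (prodBernoulli u).real {ω : BondConfig (Fin n) | (∀ x ∈ ({o₁, o₂} : Finset (Fin n)), ω ∉ openConn v x) ∧
          1 ≤ (A.filter fun z => ∃ x ∈ ({o₁, o₂} : Finset (Fin n)), ω ∈ openConn x z).card ∧
          (A.filter fun z => ∃ x ∈ ({o₁, o₂} : Finset (Fin n)), ω ∈ openConn x z).card ≤ j} +
        (prodBernoulli u).real {ω : BondConfig (Fin n) | (∃ x ∈ ({o₁, o₂} : Finset (Fin n)), ω ∈ openConn v x) ∧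
          (A.filter fun z => ω ∈ openConn v z).card ≤ j}
  let Light : (Sym2 (Fin n) → unitInterval) → Fin n → ℝ := fun u p =>
    (prodBernoulli u).real {ω : BondConfig (Fin n) | (A.filter fun z => ω ∈ openConn p z).card ≤ j}
  let N : (Sym2 (Fin n) → unitInterval) → ℕ := fun u => (Finset.univ.filter fun e : Sym2 (Fin n) => u e ≠ 0 ∧ u e ≠ 1).card
  -- the claim for all `w` with `N w ≤ K`, by induction on `K`
  suffices key : ∀ K : ℕ, ∀ u : Sym2 (Fin n) → unitInterval, u s(o₁, o₂) = 0 → (∀ x, u s(o₁, x) ≠ 0 → x ∈ A) →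
      (∀ x, u s(o₂, x) ≠ 0 → x ∈ A) → N u ≤ K →
      ∀ v ∈ A, ∃ p ∈ A, (Emass u v = 0 ∨ u s(o₁, p) ≠ 0 ∨ u s(o₂, p) ≠ 0) ∧ Emass u v ≤ Light u p by
    exact key (N w) w hw12 hpend₁ hpend₂ le_rfl
  intro K
  induction K with
  | zero =>
    intro u hu12 hp₁ hp₂ hN v hvA
    have hN0 : N u = 0 := Nat.le_zero.mp hN
    have hint : ∀ a ∈ A, (u s(o₁, a) = 0 ∨ u s(o₁, a) = 1) ∧ (u s(o₂, a) = 0 ∨ u s(o₂, a) = 1) := by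
      intro a ha
      have h0 : (Finset.univ.filter fun e : Sym2 (Fin n) => u e ≠ 0 ∧ u e ≠ 1) = ∅ := Finset.card_eq_zero.mp hN0
      rw [Finset.filter_eq_empty_iff] at h0
      constructor
      · by_contra hc; push Not at hc; exact h0 (Finset.mem_univ _) ⟨hc.1, hc.2⟩
      · by_contra hc; push Not at hc; exact h0 (Finset.mem_univ _) ⟨hc.1, hc.2⟩
    exact obsE_pair_le_port_of_integral u A o₁ o₂ j ho₁A ho₂A h12 hp₁ hp₂ hint v hvA
  | succ K ihK =>
    intro u hu12 hp₁ hp₂ hN v hvA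
    -- (DC) one fractional pair down
    have IH : ∀ u' : Sym2 (Fin n) → unitInterval, u' s(o₁, o₂) = 0 → (∀ x, u' s(o₁, x) ≠ 0 → x ∈ A) →
        (∀ x, u' s(o₂, x) ≠ 0 → x ∈ A) → N u' < N u →
        ∀ v ∈ A, ∃ p ∈ A, (Emass u' v = 0 ∨ u' s(o₁, p) ≠ 0 ∨ u' s(o₂, p) ≠ 0) ∧ Emass u' v ≤ Light u' p :=
      fun u' h1 h2 h3 hlt => ihK u' h1 h2 h3 (by omega)
    -- case 1: `v` has a fractional star pair
    by_cases hfrac : ∃ o ∈ ({o₁, o₂} : Finset (Fin n)), u s(o, v) ≠ 0 ∧ u s(o, v) ≠ 1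
    · obtain ⟨o, ho, hne0, hne1⟩ := hfrac
      have hoA : o ∉ A := by
        simp only [Finset.mem_insert, Finset.mem_singleton] at ho
        rcases ho with rfl | rfl
        · exact ho₁A
        · exact ho₂A
      have hvo : v ≠ o := fun h => hoA (h ▸ hvA)
      set u₀ := Function.update u s(v, o) 0 with hu₀
      have hkey : s(v, o) = s(o, v) := Sym2.eq_swap
      obtain ⟨hu₀12, hp₁', hp₂', hle₀, -⟩ :=
        twoStars_erase u A o₁ o₂ o v ho₁A ho₂A ho hvA hu12 hp₁ hp₂ hne0 hne1
      have hNlt : N u₀ < N u := by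
        have hkey' : s(o, v) = s(v, o) := Sym2.eq_swap
        have h := fractionalPairs_erase_lt u s(v, o) (by rw [← hkey']; exact hne0) (by rw [← hkey']; exact hne1)
        exact h
      obtain ⟨p, hpA, hp_or, hp_le⟩ := IH u₀ hu₀12 hp₁' hp₂' hNlt v hvA
      have ho' : o ∈ ({o₁, o₂} : Finset (Fin n)) := ho
      -- the glued endpoint: `E_{u₁}(v) ≤ I_{u₁}(v)`
      have h1 : Emass (Function.update u s(v, o) 1) v ≤ Light (Function.update u s(v, o) 1) v :=
        obsE_weight_one_le (Function.update u s(v, o) 1) A {o₁, o₂} o v j ho' hvo (by simp)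
      have hport_v : u s(o₁, v) ≠ 0 ∨ u s(o₂, v) ≠ 0 := by
        simp only [Finset.mem_insert, Finset.mem_singleton] at ho
        rcases ho with rfl | rfl
        · exact Or.inl hne0
        · exact Or.inr hne0
      by_cases hself : Emass u₀ v ≤ Light u₀ v
      · -- `v` itself is a common witness
        exact ⟨v, hvA, Or.inr hport_v, obsE_le_of_common_witness u A {o₁, o₂} s(v, o) v v j hself h1⟩
      · -- the witness `p ≠ v` of the deleted endpoint, via the port step
        have hpv : p ≠ v := by intro h; rw [h] at hp_le; exact hself hp_le
        have hstep := obsE_le_max_of_erase u A {o₁, o₂} o v p j ho' hvo hpv hp_le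
        have hp_port : u s(o₁, p) ≠ 0 ∨ u s(o₂, p) ≠ 0 := by
          rcases hp_or with h0 | h | h
          · exfalso; apply hself; rw [h0]; exact measureReal_nonneg
          · exact Or.inl (hle₀ _ h)
          · exact Or.inr (hle₀ _ h)
        rcases le_total (Light u v) (Light u p) with hvp | hpv'
        · exact ⟨p, hpA, Or.inr hp_port, hstep.trans (by rw [max_eq_right hvp])⟩
        · exact ⟨v, hvA, Or.inr hport_v, hstep.trans (by rw [max_eq_left hpv'])⟩
    · push Not at hfrac
      -- case 2: `v` is a glued port
      by_cases hglued : ∃ o ∈ ({o₁, o₂} : Finset (Fin n)), u s(o, v) = 1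
      · obtain ⟨o, ho, h1⟩ := hglued
        have hoA : o ∉ A := by
          simp only [Finset.mem_insert, Finset.mem_singleton] at ho
          rcases ho with rfl | rfl
          · exact ho₁A
          · exact ho₂A
        have hvo : v ≠ o := fun h => hoA (h ▸ hvA)
        have hkey : s(v, o) = s(o, v) := Sym2.eq_swap
        have hport_v : u s(o₁, v) ≠ 0 ∨ u s(o₂, v) ≠ 0 := by
          simp only [Finset.mem_insert, Finset.mem_singleton] at ho
          rcases ho with rfl | rfl
          · left; rw [h1]; exact one_ne_zero
          · right; rw [h1]; exact one_ne_zero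
        exact ⟨v, hvA, Or.inr hport_v, obsE_weight_one_le u A {o₁, o₂} o v j ho hvo (by rw [hkey]; exact h1)⟩
      · push Not at hglued
        -- case 3: `v` is an outsider
        have hv₁ : u s(o₁, v) = 0 := by
          by_contra h; exact hglued o₁ (by simp) (hfrac o₁ (by simp) h)
        have hv₂ : u s(o₂, v) = 0 := by
          by_contra h; exact hglued o₂ (by simp) (hfrac o₂ (by simp) h)
        by_cases hex : ∃ a ∈ A, (u s(o₁, a) ≠ 0 ∧ u s(o₁, a) ≠ 1) ∨ (u s(o₂, a) ≠ 0 ∧ u s(o₂, a) ≠ 1)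
        · exact hOut u ho₁A ho₂A h12 hu12 hp₁ hp₂ IH v hvA hv₁ hv₂ hex
        · -- no fractional pair at all: base case
          push Not at hex
          have hint : ∀ a ∈ A, (u s(o₁, a) = 0 ∨ u s(o₁, a) = 1) ∧ (u s(o₂, a) = 0 ∨ u s(o₂, a) = 1) := by
            intro a ha
            obtain ⟨h1, h2⟩ := hex a ha
            constructor
            · by_cases h : u s(o₁, a) = 0
              · exact Or.inl h
              · exact Or.inr (h1 h)
            · by_cases h : u s(o₂, a) = 0
              · exact Or.inl h
              · exact Or.inr (h2 h)
          exact obsE_pair_le_port_of_integral u A o₁ o₂ j ho₁A ho₂A h12 hp₁ hp₂ hint v hvA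

end HullPort

end Summit.CriticalPhenomena.PercolationContinuityZ3.Theorems

end
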